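import Summits.CriticalPhenomena.CardyFormulaZ2.Theses.CardyBondTriangular
import Summits.CriticalPhenomena.CardyFormulaZ2.Theorems.CardyBondTriangularBondTriangularCardyNegReflection
import Literature.Probability.Percolation.TriApproxDomain
import Literature.Probability.RandomPlanarGeometry.ChordalCurveFamily
import HarnessLib

/-!
# Route CardyBondTriangular · crux `BondTriangularCardy` (stmt-CriticalPhenomena-4664), line `birth`:
# stub `stub_ofAnticlockwise` — anticlockwise Carleson data suffice for critical bond-𝕋

The checked skeleton `Cruxes/BondTriangularCardy/Lines/birth.lean` produces separating data for the
crude bond-𝕋 crossing probability only for ANTICLOCKWISE Carleson data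
(`triangleTurn a b c = triOmega = ζ²`, the convention of Bollobás–Riordan, *Percolation* (2006),
Ch. 7, whose discrete domains are traversed anticlockwise and whose Lemma 13 has `ω = ζ²`). This
file proves the registered stub `theorem stub_ofAnticlockwise : Sig.stub_ofAnticlockwise` (the
signature `def Sig.stub_ofAnticlockwise` is inlined verbatim from the line lead's `Sig.lean`):
the datum-wise hypothesis of the route item `SeparatingDataToCardy` for ALL Carleson data
follows from the anticlockwise case. It is the bond-𝕋 analogue of the tree's PROVED
`Literature.Probability.Percolation.smirnov_exists_separatingData_of_anticlockwise`
(`SmirnovReflection.lean`, site-𝕋, by complex conjugation), with ONE difference: the crude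
crossing probability of the route is that of the embedded bond lattice `√3 (𝕋 − (1+ζ)/3)`
(`embDomainCrossing`), which is not `conj`-invariant but is invariant under the reflection in
the imaginary axis `ρ z = -z̄` (`imagAxisRefl`; helper file
`CardyBondTriangularBondTriangularCardyNegReflection.lean`:
`bondTriangular_real_embDomainCrossing_imagAxisRefl`). So a clockwise datum `(a, b, c, d, ψ)` of
`R` is replaced by the anticlockwise datum `(ρa, ρb, ρc, ρd, ρ ∘ ψ ∘ ρ)`
(`ConformalEquiv.reflect`) of the reflected rectangle `ρR = R.map imagAxisRefl`
(`MarkedDomain.map`: boundary loop `ρ ∘ γ`, same marks, so `pt`, `arc`, `carrier` are the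
`ρ`-images); its separating data are carried back to `R` by `isSeparatingData_ofReflect`
(`S ↦ ρ S`, `f ↦ f ∘ ρ`, `ω ↦ ω̄`; the discrete Cauchy estimate via
`discreteTriangleIntegral_comp_imagAxisRefl`), and the sandwich is unchanged because the crude
crossing probabilities of `ρR` and `R` agree (`bondTriangular_real_embDomainCrossing_map_imagAxisRefl`).

References: B. Bollobás, O. Riordan, *Percolation*, CUP 2006, Ch. 7 §7.2.2 pp. 168–169
(anticlockwise conventions), Lemma 13 p. 181 [BollobasRiordan2006].
-/

noncomputable section

namespace Summit.CriticalPhenomena.CardyFormulaZ2.Theorems.BondTriangularCardyLine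

open Set Filter Topology Metric

/-! ### The registered signature (verbatim from the line lead's `Sig.lean`) -/

/-- Signature of `stub_ofAnticlockwise` (Stub 5): anticlockwise Carleson data suffice (the bond-𝕋 analogue of the tree's PROVED
`smirnov_exists_separatingData_of_anticlockwise`): if the datum-wise hypothesis of the route item
`SeparatingDataToCardy` (two systems of separating data with `ω = triangleTurn a b c` sandwiching
the crude bond-𝕋 crossing probability at mesh `δ/√3`) holds for every conformal rectangle with an
anticlockwise Carleson datum (`triangleTurn a b c = ω = ζ²`), it holds for all Carleson data. Why
plausibly true (provable now, M): a clockwise datum of `R` is an anticlockwise datum of the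
reflected rectangle `ρR`, `ρ z = -z̄` — the embedded lattice `√3 (𝕋 − (1+ζ)/3)` is `ρ`-invariant
(site relabelling `(m, n) ↦ (-m-n, n) + e₀`; it is NOT `conj`-invariant: `conj` maps up- to
down-centroids), so the crude crossing probabilities of `ρR` and `R` agree, and separating data are
carried back as in `IsSeparatingData.ofConj` (`ω ↦ ω̄`; a `discreteTriangleIntegral_comp_neg` is
needed besides `discreteTriangleIntegral_comp_conj`). (ref: BollobasRiordan2006, Ch. 7 §7.2.2 pp. 168–169, Lemma 13 p. 181) -/
def Sig.stub_ofAnticlockwise : Prop :=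
    (∀ (R : Literature.Probability.RandomPlanarGeometry.ConformalRectangle) (a b c d : ℂ)
      (ψ : Literature.Probability.RandomPlanarGeometry.ConformalEquiv R.carrier (Literature.Probability.Percolation.openTriangle a b c)),
      Literature.Probability.Percolation.IsEquilateral a b c → d ∈ openSegment ℝ c a →
      Literature.Probability.Percolation.IsCarlesonMap R a b c d ψ →
      Literature.Probability.Percolation.triangleTurn a b c = Literature.Probability.Percolation.triOmega →
        ∃ (Sm Sp : ℝ → Finset ℂ) (fm fp : ℝ → Fin 3 → ℂ → ℝ),
          Literature.Probability.Percolation.IsSeparatingData R (Literature.Probability.Percolation.triangleTurn a b c) Sm fm ∧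
          Literature.Probability.Percolation.IsSeparatingData R (Literature.Probability.Percolation.triangleTurn a b c) Sp fp ∧
          ∃ (zm zp : ℝ → ℂ) (e : ℝ → ℝ),
            (∀ᶠ δ in 𝓝[>] (0 : ℝ), zm δ ∈ Sm δ ∧ zm δ ∈ R.carrier ∧ zp δ ∈ Sp δ ∧ zp δ ∈ R.carrier) ∧
            Tendsto zm (𝓝[>] 0) (𝓝 (R.pt 3)) ∧ Tendsto zp (𝓝[>] 0) (𝓝 (R.pt 3)) ∧
            Tendsto e (𝓝[>] 0) (𝓝 0) ∧
            ∀ᶠ δ in 𝓝[>] (0 : ℝ),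
              fm δ 1 (zm δ) - e δ ≤
                (Literature.Probability.Percolation.bondPercolation Literature.Probability.LatticeModels.triGraph (Literature.Probability.LatticeModels.criticalWeightI (Real.pi / 6))).real (Literature.Probability.Percolation.embDomainCrossing (fun x : Literature.Probability.LatticeModels.Site 2 ↦ (Real.sqrt 3 : ℂ) * (Literature.Probability.LatticeModels.triEmbed x - (1 + Literature.Probability.LatticeModels.triZeta) / 3)) R.carrier (δ / Real.sqrt 3) (R.arc 0) (R.arc 2)) ∧
              (Literature.Probability.Percolation.bondPercolation Literature.Probability.LatticeModels.triGraph (Literature.Probability.LatticeModels.criticalWeightI (Real.pi / 6))).real (Literature.Probability.Percolation.embDomainCrossing (fun x : Literature.Probability.LatticeModels.Site 2 ↦ (Real.sqrt 3 : ℂ) * (Literature.Probability.LatticeModels.triEmbed x - (1 + Literature.Probability.LatticeModels.triZeta) / 3)) R.carrier (δ / Real.sqrt 3) (R.arc 0) (R.arc 2)) ≤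
                fp δ 1 (zp δ) + e δ) →
    ∀ (R : Literature.Probability.RandomPlanarGeometry.ConformalRectangle) (a b c d : ℂ)
        (ψ : Literature.Probability.RandomPlanarGeometry.ConformalEquiv R.carrier (Literature.Probability.Percolation.openTriangle a b c)),
        Literature.Probability.Percolation.IsEquilateral a b c → d ∈ openSegment ℝ c a →
        Literature.Probability.Percolation.IsCarlesonMap R a b c d ψ →
        ∃ (Sm Sp : ℝ → Finset ℂ) (fm fp : ℝ → Fin 3 → ℂ → ℝ),
          Literature.Probability.Percolation.IsSeparatingData R (Literature.Probability.Percolation.triangleTurn a b c) Sm fm ∧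
          Literature.Probability.Percolation.IsSeparatingData R (Literature.Probability.Percolation.triangleTurn a b c) Sp fp ∧
          ∃ (zm zp : ℝ → ℂ) (e : ℝ → ℝ),
            (∀ᶠ δ in 𝓝[>] (0 : ℝ), zm δ ∈ Sm δ ∧ zm δ ∈ R.carrier ∧ zp δ ∈ Sp δ ∧ zp δ ∈ R.carrier) ∧
            Tendsto zm (𝓝[>] 0) (𝓝 (R.pt 3)) ∧ Tendsto zp (𝓝[>] 0) (𝓝 (R.pt 3)) ∧
            Tendsto e (𝓝[>] 0) (𝓝 0) ∧
            ∀ᶠ δ in 𝓝[>] (0 : ℝ),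
              fm δ 1 (zm δ) - e δ ≤
                (Literature.Probability.Percolation.bondPercolation Literature.Probability.LatticeModels.triGraph (Literature.Probability.LatticeModels.criticalWeightI (Real.pi / 6))).real (Literature.Probability.Percolation.embDomainCrossing (fun x : Literature.Probability.LatticeModels.Site 2 ↦ (Real.sqrt 3 : ℂ) * (Literature.Probability.LatticeModels.triEmbed x - (1 + Literature.Probability.LatticeModels.triZeta) / 3)) R.carrier (δ / Real.sqrt 3) (R.arc 0) (R.arc 2)) ∧
              (Literature.Probability.Percolation.bondPercolation Literature.Probability.LatticeModels.triGraph (Literature.Probability.LatticeModels.criticalWeightI (Real.pi / 6))).real (Literature.Probability.Percolation.embDomainCrossing (fun x : Literature.Probability.LatticeModels.Site 2 ↦ (Real.sqrt 3 : ℂ) * (Literature.Probability.LatticeModels.triEmbed x - (1 + Literature.Probability.LatticeModels.triZeta) / 3)) R.carrier (δ / Real.sqrt 3) (R.arc 0) (R.arc 2)) ≤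
                fp δ 1 (zp δ) + e δ

open Complex
open scoped ComplexConjugate
open Literature.Probability.Percolation Literature.Probability.RandomPlanarGeometry
open Literature.Probability.RandomPlanarGeometry.MarkedDomain
open Literature.Probability.LatticeModels

/-! ### Separating data for `R` from separating data for the reflected rectangle `ρR` -/

/-- **Separating data for `R` from separating data for the reflected rectangle
`ρR = R.map imagAxisRefl`** (same marks, boundary loop `t ↦ ρ (γ t)`): reflect the sets,
precompose the functions with `ρ` and conjugate the root of unity. The discrete Cauchy estimate
transforms by `∮ᴰ_C (F ∘ ρ) dz = conj ∮ᴰ_{C'} F dz` (`discreteTriangleIntegral_comp_imagAxisRefl`),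
the reflected lattice contour `C'` being again a lattice contour of `δ𝕋` inside `ρ K`; face
centres of `δH` reflect to face centres (`exists_hexCenter_eq_imagAxisRefl`). The bond-𝕋 analogue
of `IsSeparatingData.ofConj`. [cite: BollobasRiordan2006, Ch. 7 §7.2.2 pp. 168–169, Lemma 13 p. 181] -/
theorem isSeparatingData_ofReflect {R : ConformalRectangle} {ω : ℂ} {S : ℝ → Finset ℂ}
    {f : ℝ → Fin 3 → ℂ → ℝ} (h : IsSeparatingData (R.map imagAxisRefl) ω S f) :
    IsSeparatingData R (conj ω) (fun δ => (S δ).image imagAxisRefl)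
      (fun δ i z => f δ i (imagAxisRefl z)) where
  mem_Icc δ i w hw := by
    obtain ⟨w', hw', rfl⟩ := Finset.mem_image.1 hw
    simpa using h.mem_Icc δ i w' hw'
  dense := by
    obtain ⟨ε, hε, hd⟩ := h.dense
    refine ⟨ε, hε, hd.mono fun δ hδ z hz => ?_⟩
    have hz' : imagAxisRefl z ∈ closure (R.map imagAxisRefl).carrier := by
      rw [MarkedDomain.carrier_map, ← imagAxisRefl.image_closure]
      exact mem_image_of_mem _ hz
    obtain ⟨w, hw, hzw⟩ := hδ _ hz'
    refine ⟨imagAxisRefl w, Finset.mem_image_of_mem _ hw, ?_⟩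
    rwa [← dist_imagAxisRefl, imagAxisRefl_imagAxisRefl]
  interior K hK hKΩ := by
    have hK' : IsCompact (imagAxisRefl '' K) := hK.image imagAxisRefl.continuous
    have hK'Ω : imagAxisRefl '' K ⊆ (R.map imagAxisRefl).carrier := image_mono hKΩ
    filter_upwards [h.interior _ hK' hK'Ω] with δ hδ x hx
    obtain ⟨x', hx'⟩ := exists_hexCenter_eq_imagAxisRefl x
    have hmem : (δ : ℂ) * hexCenter x' ∈ imagAxisRefl '' K :=
      ⟨_, hx, by rw [hx', imagAxisRefl_ofReal_mul]⟩
    have := hδ x' hmem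
    refine Finset.mem_image.2 ⟨_, this, ?_⟩
    rw [hx', ← imagAxisRefl_ofReal_mul, imagAxisRefl_imagAxisRefl]
  equicontinuous β hβ := by
    obtain ⟨η, hη, he⟩ := h.equicontinuous β hβ
    refine ⟨η, hη, he.mono fun δ hδ i z hz w hw hzw => ?_⟩
    obtain ⟨z', hz', rfl⟩ := Finset.mem_image.1 hz
    obtain ⟨w', hw', rfl⟩ := Finset.mem_image.1 hw
    rw [dist_imagAxisRefl] at hzw
    simpa using hδ i z' hz' w' hw' hzw
  cauchy := by
    obtain ⟨e, he, hc⟩ := h.cauchy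
    refine ⟨e, he, fun K hK hKΩ => ?_⟩
    have hK' : IsCompact (imagAxisRefl '' K) := hK.image imagAxisRefl.continuous
    have hK'Ω : imagAxisRefl '' K ⊆ (R.map imagAxisRefl).carrier := image_mono hKΩ
    filter_upwards [hc _ hK' hK'Ω] with δ hδ i x n s hs hT
    -- the reflected contour: corner `ρ p - n s = δ · (σ̃ x - σ n e₀)`, the same signed mesh `s`
    obtain ⟨σ, hsσ⟩ : ∃ σ : ℤ, s = σ * δ := by
      rcases hs with rfl | rfl
      · exact ⟨1, by simp⟩
      · exact ⟨-1, by simp⟩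
    set x' : Site 2 := triConjFun (-x) + ![-(σ * n), 0] with hx'
    have hq : triMeshPoint δ x' = imagAxisRefl (triMeshPoint δ x) - n * s := by
      simp only [triMeshPoint, hx', triEmbed_add, triEmbed_vec, triEmbed_triConjFun, triEmbed_neg,
        map_neg, imagAxisRefl_apply, map_mul, Complex.conj_ofReal, hsσ]
      push_cast
      ring
    have hT' : convexHull ℝ {triMeshPoint δ x', triMeshPoint δ x' + n * s,
        triMeshPoint δ x' + n * s * triZeta} ⊆ imagAxisRefl '' K := by
      rw [hq, ← imagAxisRefl_image_convexHull_latticeTriangle]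
      exact image_mono hT
    have hb := hδ i x' n s hs hT'
    rw [hq] at hb
    rw [discreteTriangleIntegral_comp_imagAxisRefl, discreteTriangleIntegral_comp_imagAxisRefl,
      ← map_mul, ← map_sub, Complex.norm_conj]
    exact hb
  boundary i z hz := by
    have hz' : imagAxisRefl z ∈ (forgetLast (R.map imagAxisRefl)).boundary ''
        Ioo ((forgetLast (R.map imagAxisRefl)).mark i)
          ((forgetLast (R.map imagAxisRefl)).nextMark i) := by
      obtain ⟨t, ht, rfl⟩ := hz
      exact ⟨t, ht, rfl⟩
    obtain ⟨zs, hzs, hzt, hf0, hf1⟩ := h.boundary i _ hz'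
    refine ⟨fun δ => imagAxisRefl (zs δ),
      hzs.mono fun δ hδ => ⟨Finset.mem_image_of_mem _ hδ.1, ?_⟩, ?_, ?_, ?_⟩
    · exact (mem_image_imagAxisRefl_iff _ _).1 hδ.2
    · have := (imagAxisRefl.continuous.tendsto _).comp hzt
      rw [imagAxisRefl_imagAxisRefl] at this
      exact this
    · simpa using hf0
    · simpa using hf1

/-! ### The crude bond-𝕋 crossing probability of the reflected rectangle -/

/-- **The crude bond-𝕋 crossing probabilities of `ρR` and `R` agree** at every mesh: the carrier
and the arcs of `ρR = R.map imagAxisRefl` are the reflected ones, and the embedded bond lattice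
`√3 (𝕋 − (1+ζ)/3)` with its critical law is `ρ`-invariant
(`bondTriangular_real_embDomainCrossing_imagAxisRefl`). [folklore] -/
theorem bondTriangular_real_embDomainCrossing_map_imagAxisRefl (R : ConformalRectangle)
    (p : unitInterval) (δ : ℝ) :
    (bondPercolation triGraph p).real (embDomainCrossing
        (fun x : Site 2 => (Real.sqrt 3 : ℂ) * (triEmbed x - (1 + triZeta) / 3))
        (R.map imagAxisRefl).carrier δ ((R.map imagAxisRefl).arc 0) ((R.map imagAxisRefl).arc 2)) =
      (bondPercolation triGraph p).real (embDomainCrossing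
        (fun x : Site 2 => (Real.sqrt 3 : ℂ) * (triEmbed x - (1 + triZeta) / 3))
        R.carrier δ (R.arc 0) (R.arc 2)) := by
  rw [MarkedDomain.arc_map, MarkedDomain.arc_map, MarkedDomain.carrier_map,
    bondTriangular_real_embDomainCrossing_imagAxisRefl]

/-! ### The stub: anticlockwise Carleson data suffice -/

/-- **Stub `stub_ofAnticlockwise` of line `birth` (crux `BondTriangularCardy`,
stmt-CriticalPhenomena-4664): anticlockwise Carleson data suffice for critical bond-𝕋.** If the
datum-wise hypothesis of `SeparatingDataToCardy` (two systems of separating data with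
`ω = triangleTurn a b c` sandwiching the crude bond-𝕋 crossing probability at mesh `δ/√3`) holds
for every conformal rectangle with an anticlockwise Carleson datum (`triangleTurn a b c = ζ²`,
Bollobás–Riordan's convention), it holds for all Carleson data: the turn of a non-degenerate
equilateral triangle is `ζ²` or `conj ζ²` (`triangleTurn_eq_or_of_isEquilateral`); in the
clockwise case `(ρa, ρb, ρc, ρd, ρ ∘ ψ ∘ ρ)` (`ConformalEquiv.reflect`, `ρ z = -z̄`) is an
anticlockwise Carleson datum of the reflected rectangle `ρR = R.map imagAxisRefl`, whose
separating data are carried back by `isSeparatingData_ofReflect` (`ω ↦ ω̄`), the points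
`z∓_δ ↦ ρ z∓_δ → ρ ρ d' = d'`, and whose crude bond-𝕋 crossing probabilities equal those of `R`
(`bondTriangular_real_embDomainCrossing_map_imagAxisRefl`: the embedded bond lattice
`√3 (𝕋 − (1+ζ)/3)` is `ρ`-invariant, unlike under `conj`). [cite: BollobasRiordan2006, Ch. 7 §7.2.2 pp. 168–169, Lemma 13 p. 181] -/
theorem stub_ofAnticlockwise : Sig.stub_ofAnticlockwise := by
  intro h R a b c d ψ habc hd hψ
  rcases triangleTurn_eq_or_of_isEquilateral habc with hacw | hcw
  · exact h R a b c d ψ habc hd hψ hacw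
  -- the clockwise case: pass to the reflected rectangle `ρR`
  set R' : ConformalRectangle := R.map imagAxisRefl with hR'
  set ψ' : ConformalEquiv R'.carrier
      (openTriangle (imagAxisRefl a) (imagAxisRefl b) (imagAxisRefl c)) :=
    (ψ.reflect R.isOpen (isOpen_openTriangle a b c)).trans
      (ConformalEquiv.ofEq (imagAxisRefl_image_openTriangle a b c)) with hψ'
  have habc' := isEquilateral_imagAxisRefl habc
  have hd' := mem_openSegment_imagAxisRefl hd
  have hbv : ∀ (i : Fin 4) (w : ℂ), ψ.HasBoundaryValue (R.pt i) w →
      ψ'.HasBoundaryValue (R'.pt i) (imagAxisRefl w) := by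
    intro i w hw
    exact ConformalEquiv.hasBoundaryValue_trans _ _
      (hasBoundaryValue_reflect R.isOpen (isOpen_openTriangle a b c) hw)
      (ConformalEquiv.hasBoundaryValue_ofEq _ _)
  have hψ'C : IsCarlesonMap R' (imagAxisRefl a) (imagAxisRefl b) (imagAxisRefl c)
      (imagAxisRefl d) ψ' :=
    ⟨hbv 0 a hψ.1, hbv 1 b hψ.2.1, hbv 2 c hψ.2.2.1, hbv 3 d hψ.2.2.2⟩
  have hacw' : triangleTurn (imagAxisRefl a) (imagAxisRefl b) (imagAxisRefl c) = triOmega := by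
    rw [triangleTurn_imagAxisRefl, hcw, Complex.conj_conj, triOmega_eq]
  obtain ⟨Sm, Sp, fm, fp, hDm, hDp, zm, zp, e, hmem, hzm, hzp, he, hsand⟩ :=
    h R' _ _ _ _ ψ' habc' hd' hψ'C hacw'
  rw [hacw'] at hDm hDp
  have hω : triangleTurn a b c = conj triOmega := hcw
  rw [hω]
  refine ⟨_, _, _, _, isSeparatingData_ofReflect hDm, isSeparatingData_ofReflect hDp,
    fun δ => imagAxisRefl (zm δ), fun δ => imagAxisRefl (zp δ), e, ?_, ?_, ?_, he, ?_⟩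
  · filter_upwards [hmem] with δ hδ
    obtain ⟨h1, h2, h3, h4⟩ := hδ
    exact ⟨Finset.mem_image_of_mem _ h1, (mem_image_imagAxisRefl_iff _ _).1 h2,
      Finset.mem_image_of_mem _ h3, (mem_image_imagAxisRefl_iff _ _).1 h4⟩
  · have := (imagAxisRefl.continuous.tendsto _).comp hzm
    rw [hR', MarkedDomain.pt_map, imagAxisRefl_imagAxisRefl] at this
    exact this
  · have := (imagAxisRefl.continuous.tendsto _).comp hzp
    rw [hR', MarkedDomain.pt_map, imagAxisRefl_imagAxisRefl] at this
    exact this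
  · filter_upwards [hsand] with δ hδ
    rw [hR', bondTriangular_real_embDomainCrossing_map_imagAxisRefl] at hδ
    simpa using hδ

end Summit.CriticalPhenomena.CardyFormulaZ2.Theorems.BondTriangularCardyLine

end
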